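import Literature.NumberTheory.EllipticCurves.BSDRankZeroFamily
import Literature.NumberTheory.EllipticCurves.BSDRankZeroDensityProofs
import HarnessLib

/-!
# A positive proportion of elliptic curves over `ℚ` have rank `0`: the inputs, after the parity
# bridge

Topic `Literature/NumberTheory/EllipticCurves`, family `bsd` (**bsd.S26**). Fifth file of the
decomposition of the named fact `Literature.NumberTheory.EllipticCurves.pos_proportion_rank_zero`
(`BSDWave0.lean`):

> M. Bhargava, A. Shankar, *Ternary cubic forms having bounded invariants, and the existence of a
> positive proportion of elliptic curves having rank 0*, Ann. of Math. (2) 181 (2015) 587–621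
> = arXiv:1007.0052v2, **Theorem 4**: "When all elliptic curves `E/ℚ` are ordered by height, a
> positive proportion of them have rank `0`."

`BSDRankZeroDensity` proved the printed deduction (§4.1 of the source) of Thm 4 from Thm 27, Thm 42
and the root-number family; `BSDRankZeroSieve` and `BSDRankZeroFamily` proved everything about the
family except the one sentence `ω(E₋₁) = -ω(E)` (`pos_proportion_rank_zero_of_facts₂`: Thm 4 from
the three named facts `heightAverageOn_card_selmerThree_le_four` = Thm 27,
`even_selmerRank_sub_torsionRank_iff` = Thm 42, `rootNumber_negB_of_isBSFamily` = the sentence);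
and `BSDRankZeroDensityProofs` proved that Thm 42 — the `p`-Selmer-rank form of the `p`-parity
theorem, which the source attributes to Dokchitser–Dokchitser, Ann. of Math. 172 (2010), Thm 1.4 —
follows from the tree's own vendoring of that theorem in the Dokchitsers' corank form,
`Literature.NumberTheory.EllipticCurves.p_parity` (bsd.S19, `BSDSelmer.lean`), together with the
Cassels–Tate pairing `WeierstrassCurve.exists_casselsTate_pairing` (bsd.S18, `BSDSha.lean`)
(`even_selmerRank_sub_torsionRank_iff_of_facts`; the same parity computation is also carried out in
`CasselsTateParity.lean` / `Literature.GroupTheory.FiniteAbelian.AlternatingPairing`).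

This file records the resulting state of the decomposition in one theorem,
`pos_proportion_rank_zero_of_facts₃`: **Theorem 4 follows from**
* `heightAverageOn_card_selmerThree_le_four` — Thm 27 of the source (the average size of the
  `3`-Selmer group in a large family is `≤ 4`: ternary cubic forms, the whole geometry-of-numbers
  argument of §§2–3; particular to this theorem);
* `rootNumber_negB_of_isBSFamily` — the root-number sentence of §4.1 (`ω(E_{A,-B}) = -ω(E_{A,B})`
  on the explicit family; local root numbers at `2`, S. Wong, Compositio Math. 127 (2001) Lemma 12;
  particular to this theorem);
* `p_parity` for all `E/ℚ` and all primes `p` — Dokchitser–Dokchitser 2010 Thm 1.4 (bsd.S19,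
  shared with the rest of the family and itself decomposed along its printed proof in
  `BSDSelmerParityDokchitserProofs`, `BSDSelmerPParityProofs`);
* `exists_casselsTate_pairing` over `ℚ` — Cassels 1962 / Tate 1963 (bsd.S18, shared).

Nothing here is a discharge of `pos_proportion_rank_zero`: the four inputs are named facts of the
tree. No statement of the imported files is changed and no new fact is introduced.

## References

* [BhargavaShankarTernary2015] M. Bhargava, A. Shankar, Ann. of Math. (2) 181 (2015) 587–621 =
  arXiv:1007.0052v2: Thm 4, Thm 27, Thm 42, §4.1.
* [DokchitserDokchitserAnnals2010] T. Dokchitser, V. Dokchitser, Ann. of Math. 172 (2010)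
  567–596, Thm 1.4.
-/

noncomputable section

open scoped Classical

namespace Literature.NumberTheory.EllipticCurves

/-- **Theorem 4 of Bhargava–Shankar (ternary cubic forms) from Thm 27, the root-number sentence of
§4.1, the `p`-parity theorem in Dokchitser–Dokchitser's corank form, and the Cassels–Tate
pairing.** As `pos_proportion_rank_zero_of_facts₂` (`BSDRankZeroFamily`), with the source's Thm 42
(`even_selmerRank_sub_torsionRank_iff`) supplied by `even_selmerRank_sub_torsionRank_iff_of_facts`
(`BSDRankZeroDensityProofs`) from the tree facts `p_parity` (bsd.S19) and
`exists_casselsTate_pairing` (bsd.S18).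
[cite: BhargavaShankarTernary2015, Thm 4 and §4.1 (arXiv v2 numbering)] -/
theorem pos_proportion_rank_zero_of_facts₃ (h₁ : heightAverageOn_card_selmerThree_le_four)
    (hpar : ∀ (W : WeierstrassCurve ℚ) [W.IsElliptic] (p : ℕ) [Fact p.Prime], p_parity W p)
    (hCT : WeierstrassCurve.exists_casselsTate_pairing (K := ℚ))
    (h₄ : rootNumber_negB_of_isBSFamily) : pos_proportion_rank_zero :=
  pos_proportion_rank_zero_of_facts₂ h₁ (even_selmerRank_sub_torsionRank_iff_of_facts hpar hCT) h₄

end Literature.NumberTheory.EllipticCurves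

end
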